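import Literature.NumberTheory.Automorphic.UnitaryGroupArchimedeanPlaces
import Literature.NumberTheory.Automorphic.UnitaryGroupFormTransport
import Literature.LinearAlgebra.Matrix.UnitaryGroupConjugacyClasses
import Literature.NumberTheory.Rogawski1990.ArchimedeanTransfer
import Mathlib.Analysis.Matrix.Order
import HarnessLib

/-!
# At a DEFINITE archimedean place stable conjugacy IS conjugacy: in the compact unitary group `U(H)(ℂ)`, `H` positive (or
# negative) definite, `GL_N(ℂ)`-conjugate elements are conjugate
(Rogawski 1990 §14.2 p. 232 «if `v ∈ S ∪ S₀` stable conjugacy coincides with conjugacy in `G′_v`»; Bröcker–tom Dieck IV (2.5)–(2.6): the classes of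
`U(n)` are the characteristic polynomials)

Topic `NumberTheory/Automorphic`; namespaces `Literature.NumberTheory.Automorphic` (§1, any definite hermitian `H ∈ M_n(ℂ)`) and
`Literature.NumberTheory.Automorphic.UnitaryGroup` (§2, the one-place carriers ★ `archLocal L N H w` of LETTER #4 §5).  THEOREMS ONLY (no
definition, no instance, no named fact, no `sorry`).  Archimedean companion of ★ `LocalStableConjSplitPlace` (cell `pub/hodgecm-mathlib`, ENGINE T1):
at the places `v ∈ S₀` (where `G′_v` is compact) the hypothesis «stable conjugacy coincides with conjugacy» that ★ `Rogawski1990/LocalTransfer`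
∕ ★ `ArchimedeanTransfer` read (★ `stableOrbitalIntegral_eq_of_forall_isConj`) is DISCHARGED.

Mechanism: `H = P·P` with `P = √H` hermitian invertible (Mathlib `CFC.sqrt` in the `MatrixOrder` scope); `x ↦ P x P⁻¹` carries `U(H)(ℂ)` into the
unitary group `U(n)`, where conjugacy classes are the characteristic polynomials (★ `isConj_iff_charpoly_eq`); a unitary conjugator `V` there
pulls back to the conjugator `P⁻¹ V P ∈ U(H)(ℂ)`.

* §1 `conj_mem_unitaryGroup_of_mem_unitaryGroupOfForm` (`P x P⁻¹ ∈ U(n)` for `x ∈ U(P·P)`), **`isConj_of_exists_conj_of_posDef`** (`H` positive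
  definite: `g γ g⁻¹ = δ` in `GL_n(ℂ)` ⇒ `γ`, `δ` conjugate in `U(⋆, H)`), `unitaryGroupOfForm_neg`, `isConj_of_exists_conj_of_negDef`;
* §2 (CM, `w` a complex place with `σ_w(H)` definite) **`isConj_of_isStablyConj_archLocal_of_posDef`** ∕ `_of_negDef` in the currency ★
  `IsStablyConj (starRingEnd ℂ) (H.map w.embedding)` of LETTER #4 §5; `archLocal_stableOrbitalIntegralRel_eq_classOrbitalIntegral_of_posDef`
  (`Φ^st(γ, a) = Φ([γ], a)` on `U(σ_w H)(ℂ)`, every `γ`, every family, every `a`);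
* §3 (the product group `G′_∞ = U(H)(L ⊗ ℝ)`, `σ_w(H)` definite at EVERY complex place — the compact inner form)
  **`isConj_of_isStablyConj_arch_of_forall_definite`** (★ `archPiEquivCM`, place by place) and
  **`archStableOrbitalIntegral_eq_classOrbitalIntegral_of_forall_definite`** (★ LETTER #4's `archStableOrbitalIntegral` is a single orbital integral).

## References
* J. Rogawski, *Automorphic Representations of Unitary Groups in Three Variables* (1990), §14.2 p. 232, §14.4 p. 234 [Rogawski1990].
* T. Bröcker, T. tom Dieck, *Representations of Compact Lie Groups* (1985), IV (2.5)–(2.6) [BrockerTomDieck1985].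
-/

noncomputable section

open scoped Matrix MatrixGroups ComplexOrder MatrixOrder

namespace Literature.NumberTheory.Automorphic

open Literature.LinearAlgebra.Matrix Literature.NumberTheory.Rogawski1990

/-! ## §1 Definite hermitian forms over `ℂ`: ambient conjugacy ⇒ conjugacy in `U(⋆, H)` -/

section Definite

variable {n : Type*} [Fintype n] [DecidableEq n]

/-- For `P` hermitian invertible and `x ∈ U(⋆, P·P)` (`xᴴ (P P) x = P P`), the conjugate `P x P⁻¹` is a UNITARY matrix.
[cite: BrockerTomDieck1985, IV (2.5) (p0156)] -/
theorem conj_mem_unitaryGroup_of_mem_unitaryGroupOfForm {P : Matrix n n ℂ} (hPh : Pᴴ = P) (hPu : IsUnit P.det)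
    {x : GL n ℂ} (hx : x ∈ unitaryGroupOfForm (starRingEnd ℂ) (P * P)) :
    P * (x : Matrix n n ℂ) * P⁻¹ ∈ Matrix.unitaryGroup n ℂ := by
  rw [mem_unitaryGroupOfForm_star_iff_conjTranspose] at hx
  rw [Matrix.mem_unitaryGroup_iff']
  have hPinvh : (P⁻¹)ᴴ = P⁻¹ := by rw [Matrix.conjTranspose_nonsing_inv, hPh]
  rw [Matrix.star_eq_conjTranspose, Matrix.conjTranspose_mul, Matrix.conjTranspose_mul, hPinvh, hPh]
  calc P⁻¹ * ((x : Matrix n n ℂ)ᴴ * P) * (P * (x : Matrix n n ℂ) * P⁻¹)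
      = P⁻¹ * ((x : Matrix n n ℂ)ᴴ * (P * P) * (x : Matrix n n ℂ)) * P⁻¹ := by simp only [Matrix.mul_assoc]
    _ = P⁻¹ * (P * P) * P⁻¹ := by rw [hx]
    _ = 1 := by rw [← Matrix.mul_assoc, Matrix.nonsing_inv_mul P hPu, Matrix.one_mul, Matrix.mul_nonsing_inv P hPu]

/-- **In `U(⋆, H)(ℂ)` with `H` POSITIVE DEFINITE, elements conjugate in `GL_n(ℂ)` are conjugate**: `H = P·P` (`P = √H`), `x ↦ P x P⁻¹`
lands in `U(n)` where conjugacy is read off the characteristic polynomial (★ `isConj_iff_charpoly_eq`), and the unitary conjugator pulls back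
to `P⁻¹ V P ∈ U(⋆, H)`. [cite: Rogawski1990, §14.2 p. 232] [cite: BrockerTomDieck1985, IV (2.6) (p0156)] -/
theorem isConj_of_exists_conj_of_posDef {H : Matrix n n ℂ} (hdef : H.PosDef) (γ δ : unitaryGroupOfForm (starRingEnd ℂ) H)
    (h : ∃ g : GL n ℂ, g * (γ : GL n ℂ) * g⁻¹ = (δ : GL n ℂ)) : IsConj γ δ := by
  -- `H = P P`, `P` hermitian, invertible
  set P : Matrix n n ℂ := CFC.sqrt H with hPdef
  have hPP : P * P = H := CFC.sqrt_mul_sqrt_self H (Matrix.nonneg_iff_posSemidef.2 hdef.posSemidef)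
  have hPh : Pᴴ = P := (Matrix.nonneg_iff_posSemidef.1 (CFC.sqrt_nonneg H)).1
  have hPu : IsUnit P.det := by
    have hHu : IsUnit H.det := (Matrix.isUnit_iff_isUnit_det H).1 hdef.isUnit
    rw [← hPP, Matrix.det_mul] at hHu
    exact isUnit_of_mul_isUnit_left hHu
  have hPinvh : (P⁻¹)ᴴ = P⁻¹ := by rw [Matrix.conjTranspose_nonsing_inv, hPh]
  -- the unitary images
  have hγ' : γ.1 ∈ unitaryGroupOfForm (starRingEnd ℂ) (P * P) := by rw [hPP]; exact γ.2
  have hδ' : δ.1 ∈ unitaryGroupOfForm (starRingEnd ℂ) (P * P) := by rw [hPP]; exact δ.2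
  set U : Matrix.unitaryGroup n ℂ := ⟨P * ((γ : GL n ℂ) : Matrix n n ℂ) * P⁻¹, conj_mem_unitaryGroup_of_mem_unitaryGroupOfForm hPh hPu hγ'⟩
    with hU
  set V : Matrix.unitaryGroup n ℂ := ⟨P * ((δ : GL n ℂ) : Matrix n n ℂ) * P⁻¹, conj_mem_unitaryGroup_of_mem_unitaryGroupOfForm hPh hPu hδ'⟩
    with hV
  -- same characteristic polynomial
  obtain ⟨g, hg⟩ := h
  have hchar : ((γ : GL n ℂ) : Matrix n n ℂ).charpoly = ((δ : GL n ℂ) : Matrix n n ℂ).charpoly := by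
    rw [← hg, Units.val_mul, Units.val_mul, Matrix.coe_units_inv, Matrix.charpoly_units_conj]
  have hPmat : IsUnit P := (Matrix.isUnit_iff_isUnit_det P).2 hPu
  have hcharU : ∀ x : GL n ℂ, (P * (x : Matrix n n ℂ) * P⁻¹).charpoly = (x : Matrix n n ℂ).charpoly := fun x => by
    have hx := Matrix.charpoly_units_conj hPmat.unit (x : Matrix n n ℂ)
    rwa [hPmat.unit_spec] at hx
  have hUV : IsConj U V := (isConj_iff_charpoly_eq U V).2 (by
    change (P * ((γ : GL n ℂ) : Matrix n n ℂ) * P⁻¹).charpoly = (P * ((δ : GL n ℂ) : Matrix n n ℂ) * P⁻¹).charpoly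
    rw [hcharU, hcharU, hchar])
  obtain ⟨c, hc⟩ := isConj_iff.1 hUV
  -- the unitary conjugator `W` and its pull-back `X = P⁻¹ W P`
  set W : Matrix n n ℂ := (c : Matrix n n ℂ) with hWdef
  have hWW : Wᴴ * W = 1 := by
    rw [← Matrix.star_eq_conjTranspose]
    exact Matrix.mem_unitaryGroup_iff'.1 c.2
  have hWu : IsUnit W := ⟨Unitary.toUnits c, rfl⟩
  have hcW : W * (P * ((γ : GL n ℂ) : Matrix n n ℂ) * P⁻¹) = P * ((δ : GL n ℂ) : Matrix n n ℂ) * P⁻¹ * W := by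
    have h1 : c * U = V * c := by rw [← hc]; group
    exact congrArg Subtype.val h1
  set X : Matrix n n ℂ := P⁻¹ * W * P with hXdef
  have hXγ : X * ((γ : GL n ℂ) : Matrix n n ℂ) = ((δ : GL n ℂ) : Matrix n n ℂ) * X := by
    have h2 : W * P * ((γ : GL n ℂ) : Matrix n n ℂ) = P * ((δ : GL n ℂ) : Matrix n n ℂ) * P⁻¹ * W * P := by
      have := congrArg (fun M => M * P) hcW
      simpa only [Matrix.mul_assoc, Matrix.nonsing_inv_mul_cancel_left P _ hPu, Matrix.nonsing_inv_mul P hPu,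
        Matrix.mul_one] using this
    calc X * ((γ : GL n ℂ) : Matrix n n ℂ) = P⁻¹ * (W * P * ((γ : GL n ℂ) : Matrix n n ℂ)) := by
          simp only [hXdef, Matrix.mul_assoc]
      _ = P⁻¹ * (P * ((δ : GL n ℂ) : Matrix n n ℂ) * P⁻¹ * W * P) := by rw [h2]
      _ = ((δ : GL n ℂ) : Matrix n n ℂ) * X := by
          simp only [hXdef, Matrix.mul_assoc, Matrix.nonsing_inv_mul_cancel_left P _ hPu]
  -- `X` is invertible and preserves `H`
  have hXdet : IsUnit X.det := by
    rw [hXdef, Matrix.det_mul, Matrix.det_mul]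
    exact ((Matrix.isUnit_nonsing_inv_det P hPu).mul ((Matrix.isUnit_iff_isUnit_det W).1 hWu)).mul hPu
  have hXH : Xᴴ * H * X = H := by
    have hXct : Xᴴ = P * Wᴴ * P⁻¹ := by
      rw [hXdef, Matrix.conjTranspose_mul, Matrix.conjTranspose_mul, hPh, hPinvh, Matrix.mul_assoc]
    rw [hXct, hXdef, ← hPP]
    calc P * Wᴴ * P⁻¹ * (P * P) * (P⁻¹ * W * P)
        = P * Wᴴ * (P⁻¹ * (P * (P * (P⁻¹ * (W * P))))) := by simp only [Matrix.mul_assoc]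
      _ = P * Wᴴ * (W * P) := by rw [Matrix.nonsing_inv_mul_cancel_left P _ hPu, Matrix.mul_nonsing_inv_cancel_left P _ hPu]
      _ = P * (Wᴴ * W) * P := by simp only [Matrix.mul_assoc]
      _ = P * P := by rw [hWW, Matrix.mul_one]
  set Xu : GL n ℂ := ((Matrix.isUnit_iff_isUnit_det X).2 hXdet).unit with hXudef
  have hXuval : (Xu : Matrix n n ℂ) = X := ((Matrix.isUnit_iff_isUnit_det X).2 hXdet).unit_spec
  have hXmem : Xu ∈ unitaryGroupOfForm (starRingEnd ℂ) H :=
    mem_unitaryGroupOfForm_star_of_conjTranspose H Xu (by rw [hXuval]; exact hXH)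
  refine isConj_iff.2 ⟨⟨Xu, hXmem⟩, ?_⟩
  rw [mul_inv_eq_iff_eq_mul]
  apply Subtype.ext
  apply Units.val_injective
  change (Xu : Matrix n n ℂ) * ((γ : GL n ℂ) : Matrix n n ℂ) = ((δ : GL n ℂ) : Matrix n n ℂ) * (Xu : Matrix n n ℂ)
  rw [hXuval]
  exact hXγ

/-- `U(⋆, -H) = U(⋆, H)`: a form and its negative have the same unitary group. [cite: Rogawski1990, §14.2 p. 232] -/
theorem unitaryGroupOfForm_neg {R : Type*} [CommRing R] (σ : R →+* R) {m : Type*} [Fintype m] [DecidableEq m] (H : Matrix m m R) :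
    unitaryGroupOfForm σ (-H) = unitaryGroupOfForm σ H := by
  ext g
  simp only [mem_unitaryGroupOfForm_iff, Matrix.mul_neg, Matrix.neg_mul, neg_inj]

/-- The NEGATIVE DEFINITE case: in `U(⋆, H)(ℂ)` with `-H` positive definite, `GL_n(ℂ)`-conjugate elements are conjugate
(`U(⋆, H) = U(⋆, -H)`). [cite: Rogawski1990, §14.2 p. 232] -/
theorem isConj_of_exists_conj_of_negDef {H : Matrix n n ℂ} (hdef : (-H).PosDef) (γ δ : unitaryGroupOfForm (starRingEnd ℂ) H)
    (h : ∃ g : GL n ℂ, g * (γ : GL n ℂ) * g⁻¹ = (δ : GL n ℂ)) : IsConj γ δ := by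
  have e : unitaryGroupOfForm (starRingEnd ℂ) H = unitaryGroupOfForm (starRingEnd ℂ) (-H) := (unitaryGroupOfForm_neg _ H).symm
  have h' := isConj_of_exists_conj_of_posDef hdef ⟨γ.1, e ▸ γ.2⟩ ⟨δ.1, e ▸ δ.2⟩ h
  obtain ⟨c, hc⟩ := isConj_iff.1 h'
  refine isConj_iff.2 ⟨⟨c.1, e.symm ▸ c.2⟩, Subtype.ext ?_⟩
  have hval := congrArg Subtype.val hc
  exact hval

end Definite

namespace UnitaryGroup

open _root_.NumberField _root_.NumberField.InfinitePlace _root_.NumberField.mixedEmbedding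

/-! ## §2 The one-place archimedean groups `U(σ_w H)(ℂ) = archLocal L N H w` at a DEFINITE place -/

section CM

variable (L : Type) [Field L] [NumberField L] [IsCMField L] (N : ℕ) (H : Matrix (Fin N) (Fin N) L)
  (w : {w : InfinitePlace L // IsComplex w})

omit [NumberField L] [IsCMField L] in
/-- **At a complex place `w` where `σ_w(H)` is POSITIVE DEFINITE, stably conjugate elements of `U(σ_w H)(ℂ) = archLocal L N H w` are
conjugate** (★ `IsStablyConj (starRingEnd ℂ) (H.map w.embedding)` = `GL_N(ℂ)`-conjugacy, the currency of LETTER #4 §5).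
[cite: Rogawski1990, §14.2 p. 232] -/
theorem isConj_of_isStablyConj_archLocal_of_posDef (hdef : (H.map w.1.embedding).PosDef) (γ δ : archLocal L N H w)
    (h : IsStablyConj (starRingEnd ℂ) (H.map w.1.embedding) γ δ) : IsConj γ δ :=
  isConj_of_exists_conj_of_posDef hdef γ δ (isStablyConj_iff.1 h)

omit [NumberField L] [IsCMField L] in
/-- The NEGATIVE definite place: same conclusion. [cite: Rogawski1990, §14.2 p. 232] -/
theorem isConj_of_isStablyConj_archLocal_of_negDef (hdef : (-H.map w.1.embedding).PosDef) (γ δ : archLocal L N H w)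
    (h : IsStablyConj (starRingEnd ℂ) (H.map w.1.embedding) γ δ) : IsConj γ δ :=
  isConj_of_exists_conj_of_negDef hdef γ δ (isStablyConj_iff.1 h)

omit [NumberField L] [IsCMField L] in
/-- **`Φ^st(γ, a) = Φ([γ], a)` on `U(σ_w H)(ℂ)` at a definite place** — every `γ`, every family of orbital measures, every `a` (the stable class is a
single conjugacy class; ★ `stableOrbitalIntegralRel`). [cite: Rogawski1990, §14.2 p. 232] -/
theorem archLocal_stableOrbitalIntegralRel_eq_classOrbitalIntegral_of_posDef (hdef : (H.map w.1.embedding).PosDef)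
    [∀ γ' : archLocal L N H w, MeasurableSpace (archLocal L N H w ⧸ Subgroup.centralizer ({γ'} : Set (archLocal L N H w)))]
    (m : OrbitalMeasureFamily (archLocal L N H w)) (a : archLocal L N H w → ℂ) (γ : archLocal L N H w) :
    stableOrbitalIntegralRel (G := archLocal L N H w) (IsStablyConj (starRingEnd ℂ) (H.map w.1.embedding)) m a γ =
      classOrbitalIntegral m a (ConjClasses.mk γ) := by
  have hset : {c : ConjClasses (archLocal L N H w) | IsStablyConj (starRingEnd ℂ) (H.map w.1.embedding) γ (Quotient.out c)} =
      {ConjClasses.mk γ} := by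
    ext c
    simp only [Set.mem_setOf_eq, Set.mem_singleton_iff]
    constructor
    · intro hc
      have h1 : ConjClasses.mk γ = ConjClasses.mk (Quotient.out c) :=
        ConjClasses.mk_eq_mk_iff_isConj.2 (isConj_of_isStablyConj_archLocal_of_posDef L N H w hdef γ _ hc)
      rw [h1]
      exact (Quotient.out_eq c).symm
    · rintro rfl
      have h2 : ConjClasses.mk (Quotient.out (ConjClasses.mk γ)) = ConjClasses.mk γ := Quotient.out_eq _
      exact isStablyConj_of_isConj (ConjClasses.mk_eq_mk_iff_isConj.1 h2).symm
  rw [stableOrbitalIntegralRel_def]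
  exact (finsum_mem_congr hset fun _ _ => rfl).trans finsum_mem_singleton

/-! ## §3 The product group `G′_∞ = U(H)(L ⊗ ℝ) = arch L⁺ L c N H` for `H` definite at EVERY complex place -/

/-- **Stable conjugacy is conjugacy in `U(H)(L ⊗ ℝ)` when `σ_w(H)` is definite at every complex place `w`** (the compact inner form
`G′_∞`): place by place through ★ `archPiEquivCM : U(H)(L ⊗ ℝ) ≃ₜ* Π_w U(σ_w H)(ℂ)` and §2. [cite: Rogawski1990, §14.2 p. 232] -/
theorem isConj_of_isStablyConj_arch_of_forall_definite
    (hdef : ∀ w : {w : InfinitePlace L // IsComplex w}, (H.map w.1.embedding).PosDef ∨ (-H.map w.1.embedding).PosDef)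
    (γ δ : arch (↥(maximalRealSubfield L)) L (IsCMField.complexConj L) N H)
    (h : IsStablyConj (conjMixed (↥(maximalRealSubfield L)) L (IsCMField.complexConj L)) (archFormOf L N H) γ δ) : IsConj γ δ := by
  obtain ⟨g, hg⟩ := isStablyConj_iff.1 h
  set e := archPiEquivCM L H (N := N) with he
  -- place by place the components are stably conjugate, hence conjugate (§2)
  have hst : ∀ w : {w : InfinitePlace L // IsComplex w},
      IsStablyConj (starRingEnd ℂ) (H.map w.1.embedding) (e γ w) (e δ w) := fun w => by
    refine isStablyConj_iff.2 ⟨Matrix.GeneralLinearGroup.map (evalC L w) g, ?_⟩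
    change Matrix.GeneralLinearGroup.map (evalC L w) g *
        Matrix.GeneralLinearGroup.map (evalC L w) (γ : GL (Fin N) (mixedSpace L)) *
          (Matrix.GeneralLinearGroup.map (evalC L w) g)⁻¹ =
      Matrix.GeneralLinearGroup.map (evalC L w) (δ : GL (Fin N) (mixedSpace L))
    rw [← map_inv, ← map_mul, ← map_mul, hg]
  have hconj : ∀ w : {w : InfinitePlace L // IsComplex w}, IsConj (e γ w) (e δ w) := fun w => by
    rcases hdef w with hpos | hneg
    · exact isConj_of_isStablyConj_archLocal_of_posDef L N H w hpos _ _ (hst w)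
    · exact isConj_of_isStablyConj_archLocal_of_negDef L N H w hneg _ _ (hst w)
  choose u hu using fun w => isConj_iff.1 (hconj w)
  refine isConj_iff.2 ⟨e.symm u, e.injective ?_⟩
  rw [map_mul, map_mul, map_inv, ContinuousMulEquiv.apply_symm_apply]
  funext w
  exact hu w

/-- **`Φ^st_∞(γ, a) = Φ([γ], a)` on the compact `G′_∞ = U(H)(L ⊗ ℝ)`** (★ LETTER #4's `archStableOrbitalIntegral`) for EVERY `γ`, every family and
every `a`, when `σ_w(H)` is definite at every complex place. [cite: Rogawski1990, §14.2 p. 232] -/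
theorem archStableOrbitalIntegral_eq_classOrbitalIntegral_of_forall_definite
    (hdef : ∀ w : {w : InfinitePlace L // IsComplex w}, (H.map w.1.embedding).PosDef ∨ (-H.map w.1.embedding).PosDef)
    [∀ γ' : arch (↥(maximalRealSubfield L)) L (IsCMField.complexConj L) N H,
      MeasurableSpace (arch (↥(maximalRealSubfield L)) L (IsCMField.complexConj L) N H ⧸
        Subgroup.centralizer ({γ'} : Set (arch (↥(maximalRealSubfield L)) L (IsCMField.complexConj L) N H)))]
    (m : OrbitalMeasureFamily (arch (↥(maximalRealSubfield L)) L (IsCMField.complexConj L) N H))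
    (a : arch (↥(maximalRealSubfield L)) L (IsCMField.complexConj L) N H → ℂ)
    (γ : arch (↥(maximalRealSubfield L)) L (IsCMField.complexConj L) N H) :
    archStableOrbitalIntegral L N H m a γ = classOrbitalIntegral m a (ConjClasses.mk γ) := by
  have hset : {c : ConjClasses (arch (↥(maximalRealSubfield L)) L (IsCMField.complexConj L) N H) |
      IsStablyConj (conjMixed (↥(maximalRealSubfield L)) L (IsCMField.complexConj L)) (archFormOf L N H) γ (Quotient.out c)} =
      {ConjClasses.mk γ} := by
    ext c
    simp only [Set.mem_setOf_eq, Set.mem_singleton_iff]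
    constructor
    · intro hc
      have h1 : ConjClasses.mk γ = ConjClasses.mk (Quotient.out c) :=
        ConjClasses.mk_eq_mk_iff_isConj.2 (isConj_of_isStablyConj_arch_of_forall_definite L N H hdef γ _ hc)
      rw [h1]
      exact (Quotient.out_eq c).symm
    · rintro rfl
      have h2 : ConjClasses.mk (Quotient.out (ConjClasses.mk γ)) = ConjClasses.mk γ := Quotient.out_eq _
      exact isStablyConj_of_isConj (ConjClasses.mk_eq_mk_iff_isConj.1 h2).symm
  rw [archStableOrbitalIntegral, stableOrbitalIntegralRel_def]
  exact (finsum_mem_congr hset fun _ _ => rfl).trans finsum_mem_singleton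

end CM

end UnitaryGroup

end Literature.NumberTheory.Automorphic

end
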